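import Summits.HubbardSuperconductivity.HubbardSuperconductivity.Theorems.DeformationLadderLowEnergyRigidityTelescopeRigidityConverse
import Summits.HubbardSuperconductivity.HubbardSuperconductivity.Theorems.DeformationLadderLowEnergyRigidityDefs
import Literature.MathematicalPhysics.QuantumLattice.BlockPairPlancherel

/-!
# Telescope rigidity, part 10: mesoscopic rigidity also gives pair-momentum rigidity at the point

Route `DeformationLadder`, crux `LowEnergyRigidity` (item stmt-HubbardSuperconductivity-1892), line
`Sketch` (poincare-telescope). Support file (`--supports stmt-HubbardSuperconductivity-1892`).

The third stiffness socket on record for this crux is the inheritance cut's `MesoRigidityAt U δ`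
(`Theorems/DeformationLadderLowEnergyRigidityDefs.lean`, line `SketchIdeator1`): sliding-block pair order
in excess of the global LRO costs total energy, `γ(Re⟨𝓜_R⟩/(L²R⁴) − Re⟨Δ_dᴴΔ_d⟩/L⁴ − σ) ≤ Re⟨H⟩ − E₀`.
By block Plancherel (`Literature…BlockPairPlancherel.sum_conjTranspose_block_mul_block`) the excess is
`Σ_{m ≠ 0} f_R(m) P_m` with the normalised box kernel `f_R(m) = |F_R(m)|²/R⁴ ≥ 0`, and on the infrared
window (`‖m i‖ ≤ K`, `2KR ≤ L`) `f_R(m) ≥ (2/π)⁴` (geometric sums: `|Σ_{t<R} e(qt)| = |sin(πRy)|/|sin(πy)|`,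
Jordan below, `sin x ≤ x` above). Hence `MesoRigidityAt U δ` implies the body of
`TwistGap.TgPairMomentumRigidity` at `(U, δ)` (`pairMomentumRigidity_of_mesoRigidityAt`): together with
parts 3, 6 and 9b, EVERY stiffness socket filed for this crux (Josephson family, top-scale cell rigidity,
mesoscopic rigidity) implies TwistGap's rigidity child at the point. CONDITIONAL in use; no definitions.
[folklore]
-/

noncomputable section

namespace Summit.HubbardSuperconductivity.HubbardSuperconductivity.Theorems.LowEnergyRigidity.Telescope

set_option linter.dupNamespace false -- summit = problem name (single-conjunct summit), D-0017

open Matrix Literature.MathematicalPhysics.QuantumLattice Literature.Probability.LatticeModels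
open scoped ComplexConjugate ComplexOrder
open Summit.HubbardSuperconductivity.HubbardSuperconductivity.Theses.DeformationLadder
open Summit.HubbardSuperconductivity.HubbardSuperconductivity.Theorems.LowEnergyRigidity (blockPair mesoOp MesoRigidityAt)
open Summit.HubbardSuperconductivity.HubbardSuperconductivity.Theorems (minEnergyOn_le_re_rayleigh)

/-! ### The block pair operator in the Plancherel parametrisation -/

/-- The route's block pair operator `B_R(a)` (offsets `Fin R × Fin R` through `Torus.proj`) is the block
of `BlockPairPlancherel` (offsets `Fin 2 → Fin R`). [folklore] -/
theorem rigm_blockPair_eq (L : ℕ) [NeZero L] (R : ℕ) (a : TorusSite 2 L) :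
    blockPair L R a = ∑ u : Fin 2 → Fin R, localPair dWaveFormFactor L (a + fun i => ((u i : ℕ) : ZMod L)) := by
  unfold blockPair
  refine Fintype.sum_equiv (piFinTwoEquiv fun _ : Fin 2 => Fin R).symm _ _ fun p => ?_
  congr 2
  funext i
  fin_cases i <;> simp [Torus.proj_apply, piFinTwoEquiv_symm_apply]

/-! ### Geometric character sums: a lower bound on the window -/

/-- `|sin(π q.val R / L)| = |sin(π ‖q‖ R / L)|` and `|sin(π q.val / L)| ≤ π ‖q‖ / L`, `‖q‖ = min(q.val, L − q.val)`. [folklore] -/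
theorem rigm_sin_facts (L : ℕ) [NeZero L] (R : ℕ) (q : ZMod L) :
    |Real.sin (Real.pi * ((q.val : ℝ) * R / L))| = |Real.sin (Real.pi * (((min q.val (L - q.val) : ℕ) : ℝ) * R / L))| ∧
      |Real.sin (Real.pi * ((q.val : ℝ) / L))| ≤ Real.pi * ((min q.val (L - q.val) : ℕ) : ℝ) / L := by
  have hL : (0 : ℝ) < L := Nat.cast_pos.mpr (Nat.pos_of_ne_zero (NeZero.ne L))
  have hlt : q.val < L := ZMod.val_lt q
  rcases le_or_gt (2 * q.val) L with h | h
  · have hmin : min q.val (L - q.val) = q.val := min_eq_left (by omega)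
    rw [hmin]
    refine ⟨rfl, ?_⟩
    have h0 : 0 ≤ Real.pi * ((q.val : ℝ) / L) := by positivity
    rw [abs_of_nonneg (Real.sin_nonneg_of_nonneg_of_le_pi h0 ?_)]
    · rw [mul_div_assoc]; exact Real.sin_le h0
    · have : (q.val : ℝ) / L ≤ 1 := by rw [div_le_one hL]; exact_mod_cast hlt.le
      nlinarith [Real.pi_pos]
  · have hmin : min q.val (L - q.val) = L - q.val := min_eq_right (by omega)
    rw [hmin, Nat.cast_sub hlt.le]
    constructor
    · have h1 : Real.pi * ((q.val : ℝ) * R / L) = R * Real.pi - Real.pi * (((L : ℝ) - q.val) * R / L) := by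
        field_simp; ring
      rw [h1, Real.sin_nat_mul_pi_sub, abs_neg, abs_mul, abs_pow, abs_neg, abs_one, one_pow, one_mul]
    · have h1 : Real.pi * ((q.val : ℝ) / L) = Real.pi - Real.pi * (((L : ℝ) - q.val) / L) := by
        field_simp; ring
      rw [h1, Real.sin_pi_sub]
      have h0 : 0 ≤ Real.pi * (((L : ℝ) - q.val) / L) := by
        have : (q.val : ℝ) ≤ L := by exact_mod_cast hlt.le
        positivity
      rw [abs_of_nonneg (Real.sin_nonneg_of_nonneg_of_le_pi h0 ?_)]
      · rw [mul_div_assoc]; exact Real.sin_le h0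
      · have : ((L : ℝ) - q.val) / L ≤ 1 := by
          rw [div_le_one hL]; linarith [(Nat.cast_nonneg q.val : (0 : ℝ) ≤ q.val)]
        nlinarith [Real.pi_pos]

/-- **Window lower bound for the box sum**: if `2 ‖q‖ R ≤ L` then `2R/π ≤ ‖Σ_{t<R} e(q t)‖`. [folklore] -/
theorem rigm_norm_boxSum_ge (L : ℕ) [NeZero L] (R : ℕ) (q : ZMod L) (hq : 2 * min q.val (L - q.val) * R ≤ L) :
    2 * (R : ℝ) / Real.pi ≤ ‖∑ t : Fin R, (ZMod.stdAddChar (q * ((t : ℕ) : ZMod L)) : ℂ)‖ := by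
  have hL : (0 : ℝ) < L := Nat.cast_pos.mpr (Nat.pos_of_ne_zero (NeZero.ne L))
  have hπ := Real.pi_pos
  -- rewrite as a geometric sum in `z = e(q)`
  have hgeom : ∑ t : Fin R, (ZMod.stdAddChar (q * ((t : ℕ) : ZMod L)) : ℂ) = ∑ t ∈ Finset.range R, (ZMod.stdAddChar q : ℂ) ^ t := by
    rw [Finset.sum_range]
    refine Finset.sum_congr rfl fun t _ => ?_
    rw [show q * ((t : ℕ) : ZMod L) = (t : ℕ) • q by rw [nsmul_eq_mul, mul_comm], AddChar.map_nsmul_eq_pow]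
  rw [hgeom]
  by_cases hq0 : q = 0
  · -- all terms are `1`
    subst hq0
    simp only [AddChar.map_zero_eq_one, one_pow, Finset.sum_const, Finset.card_range, nsmul_eq_mul, mul_one,
      Complex.norm_natCast]
    rw [div_le_iff₀ hπ]
    nlinarith [Real.pi_gt_three, (Nat.cast_nonneg R : (0 : ℝ) ≤ R)]
  · -- `‖Σ z^t‖ = |sin(π R y)| / |sin(π y)|`, `y = q.val/L`
    set y : ℝ := (q.val : ℝ) / L with hy
    have hz : (ZMod.stdAddChar q : ℂ) = Complex.exp (Complex.I * ((2 * Real.pi * y : ℝ) : ℂ)) := by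
      rw [rigc_stdAddChar_eq_exp]
    have hq1 : 0 < q.val := Nat.pos_of_ne_zero fun h => hq0 ((ZMod.val_eq_zero q).mp h)
    have hm0 : 0 < min q.val (L - q.val) := lt_min hq1 (by have := ZMod.val_lt q; omega)
    have hmr : (0 : ℝ) < ((min q.val (L - q.val) : ℕ) : ℝ) := by exact_mod_cast hm0
    obtain ⟨hnum, hden⟩ := rigm_sin_facts L R q
    -- the denominator is nonzero and small, the numerator is large
    have hsin := rigc_sin_ge L q
    have hden0 : 0 < |Real.sin (Real.pi * y)| := by
      have : 0 < 2 * ((min q.val (L - q.val) : ℕ) : ℝ) / L := by positivity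
      rw [hy]; linarith
    have hz1 : ‖(ZMod.stdAddChar q : ℂ) - 1‖ = 2 * |Real.sin (Real.pi * y)| := by
      rw [hz, Complex.norm_exp_I_mul_ofReal_sub_one, Real.norm_eq_abs, abs_mul, abs_two,
        show 2 * Real.pi * y / 2 = Real.pi * y by ring]
    have hzR : ‖(ZMod.stdAddChar q : ℂ) ^ R - 1‖ = 2 * |Real.sin (Real.pi * ((q.val : ℝ) * R / L))| := by
      rw [hz, ← Complex.exp_nat_mul, show (R : ℂ) * (Complex.I * ((2 * Real.pi * y : ℝ) : ℂ)) =
        Complex.I * ((2 * Real.pi * (y * R) : ℝ) : ℂ) by push_cast; ring, Complex.norm_exp_I_mul_ofReal_sub_one,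
        Real.norm_eq_abs, abs_mul, abs_two, hy]
      congr 2
      field_simp
    have hne : (ZMod.stdAddChar q : ℂ) ≠ 1 := by
      intro h1
      have : ‖(ZMod.stdAddChar q : ℂ) - 1‖ = 0 := by rw [h1, sub_self, norm_zero]
      rw [hz1] at this
      linarith
    rw [geom_sum_eq hne, norm_div, hzR, hz1, hnum]
    -- Jordan below: `2 m R / L ≤ |sin(π m R / L)|` since `m R / L ≤ 1/2`
    have hj : 2 * (((min q.val (L - q.val) : ℕ) : ℝ) * R / L) ≤ |Real.sin (Real.pi * (((min q.val (L - q.val) : ℕ) : ℝ) * R / L))| := by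
      have habs : |(((min q.val (L - q.val) : ℕ) : ℝ) * R / L)| ≤ 1 / 2 := by
        rw [abs_of_nonneg (by positivity), div_le_iff₀ hL]
        have : (2 * min q.val (L - q.val) * R : ℕ) ≤ L := hq
        have : (2 : ℝ) * ((min q.val (L - q.val) : ℕ) : ℝ) * R ≤ L := by exact_mod_cast this
        linarith
      have := Literature.Analysis.FunctionSpaces.Torus.two_mul_abs_le_abs_sin_pi_mul habs
      rwa [abs_of_nonneg (by positivity : (0 : ℝ) ≤ ((min q.val (L - q.val) : ℕ) : ℝ) * R / L)] at this
    -- combine: `(2 m R/L)·2 / (2 · π m / L) = 2R/π`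
    rw [le_div_iff₀ (by positivity)]
    have hden' : 2 * |Real.sin (Real.pi * y)| ≤ 2 * (Real.pi * ((min q.val (L - q.val) : ℕ) : ℝ) / L) := by
      rw [hy]; linarith
    calc 2 * (R : ℝ) / Real.pi * (2 * |Real.sin (Real.pi * y)|)
        ≤ 2 * (R : ℝ) / Real.pi * (2 * (Real.pi * ((min q.val (L - q.val) : ℕ) : ℝ) / L)) :=
          mul_le_mul_of_nonneg_left hden' (by positivity)
      _ = 2 * (2 * (((min q.val (L - q.val) : ℕ) : ℝ) * R / L)) := by field_simp
      _ ≤ 2 * |Real.sin (Real.pi * (((min q.val (L - q.val) : ℕ) : ℝ) * R / L))| := by linarith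

/-- The box kernel `F_R(m) = Σ_{u ∈ [0,R)²} χ_m(u)` factorises over the coordinates. [folklore] -/
theorem rigm_boxKernel_eq_prod (L : ℕ) [NeZero L] (R : ℕ) (m : TorusSite 2 L) :
    ∑ u : Fin 2 → Fin R, torusChar m (fun i => ((u i : ℕ) : ZMod L)) =
      ∏ i : Fin 2, ∑ t : Fin R, (ZMod.stdAddChar (m i * ((t : ℕ) : ZMod L)) : ℂ) := by
  rw [Finset.prod_univ_sum]
  simp only [Fintype.piFinset_univ]
  rfl

/-- **Window lower bound for the box kernel**: if `‖m i‖ ≤ K` for both coordinates and `2KR ≤ L`, then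
`(2R/π)⁴ ≤ ‖F_R(m)‖²`. [folklore] -/
theorem rigm_boxKernel_window_ge (L : ℕ) [NeZero L] (R K : ℕ) (hKR : 2 * K * R ≤ L) (m : TorusSite 2 L)
    (hm : ∀ i : Fin 2, min (m i).val (L - (m i).val) ≤ K) :
    (2 * (R : ℝ) / Real.pi) ^ 4 ≤ ‖∑ u : Fin 2 → Fin R, torusChar m (fun i => ((u i : ℕ) : ZMod L))‖ ^ 2 := by
  rw [rigm_boxKernel_eq_prod, Fin.prod_univ_two, norm_mul, mul_pow]
  have hb : ∀ i : Fin 2, 2 * (R : ℝ) / Real.pi ≤ ‖∑ t : Fin R, (ZMod.stdAddChar (m i * ((t : ℕ) : ZMod L)) : ℂ)‖ := fun i =>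
    rigm_norm_boxSum_ge L R (m i) (le_trans (Nat.mul_le_mul_right R (Nat.mul_le_mul_left 2 (hm i))) hKR)
  have h0 : 0 ≤ 2 * (R : ℝ) / Real.pi := by positivity
  have h1 := pow_le_pow_left₀ h0 (hb 0) 2
  have h2 := pow_le_pow_left₀ h0 (hb 1) 2
  calc (2 * (R : ℝ) / Real.pi) ^ 4 = (2 * (R : ℝ) / Real.pi) ^ 2 * (2 * (R : ℝ) / Real.pi) ^ 2 := by ring
    _ ≤ _ := mul_le_mul h1 h2 (by positivity) (by positivity)

/-! ### Block Plancherel for the mesoscopic order operator -/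

/-- **Block Plancherel for `𝓜_R`**: `L² Re⟨φ, 𝓜_R φ⟩ = Σ_m ‖F_R(m)‖² ‖Δ_d(m) φ‖₂²` with the pair modes
`Δ_d(m) φ = Σ_y conj χ_m(y) P_y φ`. [folklore] -/
theorem rigm_re_expect_mesoOp (L : ℕ) [NeZero L] (R : ℕ) (φ : Fock (Orb (FermionTorus 2 L))) :
    (L : ℝ) ^ 2 * (expect (mesoOp L R) φ).re =
      ∑ m : TorusSite 2 L, ‖∑ u : Fin 2 → Fin R, torusChar m (fun i => ((u i : ℕ) : ZMod L))‖ ^ 2 *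
        eucNorm (∑ y : TorusSite 2 L, conj (torusChar m y) • (localPair dWaveFormFactor L y *ᵥ φ)) ^ 2 := by
  have h := sum_conjTranspose_block_mul_block (L := L) dWaveFormFactor R
  have hmeso : mesoOp L R = ∑ a : TorusSite 2 L,
      (∑ u : Fin 2 → Fin R, localPair dWaveFormFactor L (a + fun i => ((u i : ℕ) : ZMod L)))ᴴ *
        (∑ u : Fin 2 → Fin R, localPair dWaveFormFactor L (a + fun i => ((u i : ℕ) : ZMod L))) := by
    unfold mesoOp
    simp_rw [rigm_blockPair_eq]
  rw [← hmeso] at h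
  have h2 := congrArg (fun T => (star φ ⬝ᵥ (T *ᵥ φ)).re) h
  simp only [Matrix.smul_mulVec, dotProduct_smul, Matrix.sum_mulVec, dotProduct_sum, Complex.re_sum, smul_eq_mul] at h2
  have hL2 : ((L : ℂ) ^ 2 * (star φ ⬝ᵥ mesoOp L R *ᵥ φ)).re = (L : ℝ) ^ 2 * (expect (mesoOp L R) φ).re := by
    rw [show ((L : ℂ) ^ 2) = (((L : ℝ) ^ 2 : ℝ) : ℂ) by push_cast; ring, Complex.re_ofReal_mul]
    rfl
  rw [← hL2, h2]
  refine Finset.sum_congr rfl fun m _ => ?_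
  have hF : conj (∑ u : Fin 2 → Fin R, torusChar m (fun i => ((u i : ℕ) : ZMod L))) *
      (∑ u : Fin 2 → Fin R, torusChar m (fun i => ((u i : ℕ) : ZMod L))) =
      (((‖∑ u : Fin 2 → Fin R, torusChar m (fun i => ((u i : ℕ) : ZMod L))‖ ^ 2 : ℝ)) : ℂ) := by
    rw [mul_comm, Complex.mul_conj, Complex.normSq_eq_norm_sq]
  rw [hF, Complex.re_ofReal_mul]
  congr 1
  have hmode : pairFieldAt dWaveFormFactor L m *ᵥ φ = ∑ y : TorusSite 2 L, conj (torusChar m y) • (localPair dWaveFormFactor L y *ᵥ φ) := by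
    rw [pairFieldAt_eq_sum_torusChar, rig_sum_smul_mulVec]
  rw [← hmode, ← rig_re_expect_gram]
  rfl

/-! ### Mesoscopic rigidity gives pair-momentum rigidity -/

/-- **Mesoscopic rigidity implies pair-momentum rigidity at the point.** `MesoRigidityAt U δ` (the
inheritance cut's stiffness input) implies the body of `TwistGap.TgPairMomentumRigidity` at `(U, δ)`:
the mesoscopic excess `Re⟨𝓜_R⟩/(L²R⁴) − Re⟨Δ_dᴴΔ_d⟩/L⁴ = Σ_{m≠0} f_R(m) P_m` dominates `(2/π)⁴` times the
nonzero window weight once `L ≥ 2KR`. CONDITIONAL (the hypothesis is conjecture-grade). [folklore] -/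
theorem pairMomentumRigidity_of_mesoRigidityAt :
    ∀ (U δ : ℝ), MesoRigidityAt U δ →
    ∀ (K : ℕ) (σ : ℝ), 0 < σ → ∃ γ : ℝ, 0 < γ ∧ ∃ L₀ : ℕ, ∀ (L : ℕ) [NeZero L], L₀ ≤ L → Even L →
      ∀ φ : Fock (Orb (FermionTorus 2 L)),
        φ ∈ (szSector (Λ := FermionTorus 2 L) (2 * ⌊(1 - δ) * (L : ℝ) ^ 2 / 2⌋₊) 0) → star φ ⬝ᵥ φ = 1 →
        γ * ((∑ k ∈ (Finset.univ.filter (fun k : TorusSite 2 L => k ≠ 0 ∧ ∀ i : Fin 2, min (k i).val (L - (k i).val) ≤ K)),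
            (expect (Matrix.conjTranspose (∑ x : TorusSite 2 L, Complex.exp (-(2 * (Real.pi : ℂ) * Complex.I / (L : ℂ)) *
                ((∑ i : Fin 2, (k i).val * (x i).val : ℕ) : ℂ)) • localPair dWaveFormFactor L x) *
              (∑ x : TorusSite 2 L, Complex.exp (-(2 * (Real.pi : ℂ) * Complex.I / (L : ℂ)) *
                ((∑ i : Fin 2, (k i).val * (x i).val : ℕ) : ℂ)) • localPair dWaveFormFactor L x)) φ).re / (L : ℝ) ^ 4) - σ) ≤
          (expect (hubbardTorus 2 L 1 U) φ).re -
            (hubbardTorus 2 L 1 U).minEnergyOn (szSector (Λ := FermionTorus 2 L) (2 * ⌊(1 - δ) * (L : ℝ) ^ 2 / 2⌋₊) 0) := by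
  intro U δ hM K σ hσ
  have hπ := Real.pi_pos
  set c : ℝ := (2 / Real.pi) ^ 4 with hc
  have hc0 : 0 < c := by positivity
  obtain ⟨R₁, hR₁⟩ := hM (c * σ) (by positivity)
  set R : ℕ := max R₁ 1 with hRdef
  have hR1 : 1 ≤ R := le_max_right _ _
  have hRr : (0 : ℝ) < R := by exact_mod_cast hR1
  obtain ⟨γ, hγ, L₀, hRig⟩ := hR₁ R (le_max_left _ _)
  refine ⟨c * γ, by positivity, max L₀ (2 * K * R), ?_⟩
  intro L _ hL hev φ hφK hφ1
  have hL0 : L₀ ≤ L := le_trans (le_max_left _ _) hL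
  have hKR : 2 * K * R ≤ L := le_trans (le_max_right _ _) hL
  have hLr : (0 : ℝ) < L := Nat.cast_pos.mpr (Nat.pos_of_ne_zero (NeZero.ne L))
  have h1 := hRig L hL0 hev φ hφK hφ1
  -- abbreviations
  set E : ℝ := (star φ ⬝ᵥ hubbardTorus 2 L 1 U *ᵥ φ).re -
    (hubbardTorus 2 L 1 U).minEnergyOn (szSector (Λ := FermionTorus 2 L) (2 * ⌊(1 - δ) * (L : ℝ) ^ 2 / 2⌋₊) 0) with hE
  set P : TorusSite 2 L → ℝ := fun m =>
    eucNorm (∑ y : TorusSite 2 L, conj (torusChar m y) • (localPair dWaveFormFactor L y *ᵥ φ)) ^ 2 / (L : ℝ) ^ 4 with hP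
  set F : TorusSite 2 L → ℝ := fun m => ‖∑ u : Fin 2 → Fin R, torusChar m (fun i => ((u i : ℕ) : ZMod L))‖ ^ 2 with hF
  set W' := Finset.univ.filter (fun k : TorusSite 2 L => k ≠ 0 ∧ ∀ i : Fin 2, min (k i).val (L - (k i).val) ≤ K) with hW'
  have hP0 : ∀ m, 0 ≤ P m := fun m => by rw [hP]; positivity
  have hF0 : ∀ m, 0 ≤ F m := fun m => by rw [hF]; positivity
  -- the window sum in vector form
  have hwin : (∑ k ∈ W', (expect (Matrix.conjTranspose (∑ x : TorusSite 2 L, Complex.exp (-(2 * (Real.pi : ℂ) * Complex.I / (L : ℂ)) *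
          ((∑ i : Fin 2, (k i).val * (x i).val : ℕ) : ℂ)) • localPair dWaveFormFactor L x) *
        (∑ x : TorusSite 2 L, Complex.exp (-(2 * (Real.pi : ℂ) * Complex.I / (L : ℂ)) *
          ((∑ i : Fin 2, (k i).val * (x i).val : ℕ) : ℂ)) • localPair dWaveFormFactor L x)) φ).re / (L : ℝ) ^ 4) =
      ∑ k ∈ W', P k := by
    refine Finset.sum_congr rfl fun k _ => ?_
    rw [rigc_windowTerm_eq]
  rw [hwin]
  -- block Plancherel: the mesoscopic excess is `Σ_{m ≠ 0} F(m) P(m) / R⁴`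
  have hbp := rigm_re_expect_mesoOp L R φ
  have hF00 : F 0 = (R : ℝ) ^ 4 := by
    rw [hF]
    simp only
    have : ∀ u : Fin 2 → Fin R, torusChar (0 : TorusSite 2 L) (fun i => ((u i : ℕ) : ZMod L)) = 1 := fun u => by
      rw [torusChar_comm]; simp [torusChar]
    simp only [this, Finset.sum_const, Finset.card_univ, Fintype.card_fun, Fintype.card_fin, nsmul_eq_mul, mul_one,
      Complex.norm_natCast]
    push_cast; ring
  have hP00 : P 0 = (expect ((pairField dWaveFormFactor L)ᴴ * pairField dWaveFormFactor L) φ).re / (L : ℝ) ^ 4 := by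
    rw [hP]
    simp only
    congr 1
    have hmode : pairField dWaveFormFactor L *ᵥ φ = ∑ y : TorusSite 2 L, conj (torusChar (0 : TorusSite 2 L) y) •
        (localPair dWaveFormFactor L y *ᵥ φ) := by
      rw [← pairFieldAt_zero, pairFieldAt_eq_sum_torusChar, rig_sum_smul_mulVec]
    rw [← hmode, rig_re_expect_gram]
  have hexcess : (expect (mesoOp L R) φ).re / ((L : ℝ) ^ 2 * (R : ℝ) ^ 4) -
      (expect ((pairField dWaveFormFactor L)ᴴ * pairField dWaveFormFactor L) φ).re / (L : ℝ) ^ 4 =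
      (∑ m ∈ Finset.univ.erase (0 : TorusSite 2 L), F m * P m) / (R : ℝ) ^ 4 := by
    have hsplit : ∑ m : TorusSite 2 L, F m * P m = F 0 * P 0 + ∑ m ∈ Finset.univ.erase (0 : TorusSite 2 L), F m * P m :=
      (Finset.add_sum_erase _ _ (Finset.mem_univ _)).symm
    have htot : ∑ m : TorusSite 2 L, F m * P m = (L : ℝ) ^ 2 * (expect (mesoOp L R) φ).re / (L : ℝ) ^ 4 := by
      rw [hbp, Finset.sum_div]
      refine Finset.sum_congr rfl fun m _ => ?_
      rw [hF, hP]
      simp only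
      ring
    rw [hF00, hP00] at hsplit
    rw [hsplit] at htot
    field_simp
    field_simp at htot
    linarith
  -- lower bound on the window: `c R⁴ Σ_{W'} P ≤ Σ_{m ≠ 0} F P`
  have hsub : W' ⊆ Finset.univ.erase (0 : TorusSite 2 L) := by
    intro m hm
    rw [hW', Finset.mem_filter] at hm
    exact Finset.mem_erase.mpr ⟨hm.2.1, Finset.mem_univ _⟩
  have hlow : c * (R : ℝ) ^ 4 * ∑ m ∈ W', P m ≤ ∑ m ∈ Finset.univ.erase (0 : TorusSite 2 L), F m * P m := by
    calc c * (R : ℝ) ^ 4 * ∑ m ∈ W', P m = ∑ m ∈ W', c * (R : ℝ) ^ 4 * P m := by rw [Finset.mul_sum]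
      _ ≤ ∑ m ∈ W', F m * P m := by
          refine Finset.sum_le_sum fun m hm => ?_
          rw [hW', Finset.mem_filter] at hm
          refine mul_le_mul_of_nonneg_right ?_ (hP0 m)
          have := rigm_boxKernel_window_ge L R K hKR m hm.2.2
          rw [hc]
          calc (2 / Real.pi) ^ 4 * (R : ℝ) ^ 4 = (2 * (R : ℝ) / Real.pi) ^ 4 := by ring
            _ ≤ F m := this
      _ ≤ ∑ m ∈ Finset.univ.erase (0 : TorusSite 2 L), F m * P m :=
          Finset.sum_le_sum_of_subset_of_nonneg hsub fun m _ _ => mul_nonneg (hF0 m) (hP0 m)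
  -- combine with mesoscopic rigidity
  have hE1 : γ * ((∑ m ∈ Finset.univ.erase (0 : TorusSite 2 L), F m * P m) / (R : ℝ) ^ 4 - c * σ) ≤ E := by
    rw [← hexcess]; exact h1
  have h2 : c * ∑ m ∈ W', P m ≤ (∑ m ∈ Finset.univ.erase (0 : TorusSite 2 L), F m * P m) / (R : ℝ) ^ 4 := by
    rw [le_div_iff₀ (by positivity)]; linarith
  have h3 : γ * (c * ∑ m ∈ W', P m - c * σ) ≤ E := by
    refine le_trans (mul_le_mul_of_nonneg_left (by linarith) hγ.le) hE1
  calc c * γ * (∑ m ∈ W', P m - σ) = γ * (c * ∑ m ∈ W', P m - c * σ) := by ring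
    _ ≤ E := h3

end Summit.HubbardSuperconductivity.HubbardSuperconductivity.Theorems.LowEnergyRigidity.Telescope
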